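import Mathlib
import HarnessLib
import Summits.SmoothPoincare4.SmoothPoincare4.Theses.OneHandleSplitting

/-!
# Birth skeleton (BC3) — crux `OneHandleSplitting.PinchedStabilisation` (stmt-SmoothPoincare4-8118)

Route `route-SmoothPoincare4-OneHandleSplitting`, crux #3 `PinchedStabilisation` (the thesis X, existence half):
for every closed smooth `M ≃ₕ S⁴` there is `κ > 0` such that for every `δ > 0` some connected sum
`P = M # (S¹×S³)` (relational `IsConnectedSum`, `P` modelled on `𝓡 4`) carries a `C^∞` metric `g` with
Levi-Civita connection, `diam(P, g) ≤ 1`, `sec_g ≥ −κ` (Gram form) and `Ric_g ≥ −δ·g`.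

THE LINE ("fibre, recognise, remetrise") = the route's own reading of X made into a checked decomposition.
The route records (crux docstring) that X is ZERO-SLACK — `SPC4 ⇒ X` by the product metric on `S¹(a)×S³(b)`,
`X ⇒ SPC4` by FibrationRecognition + OneHandleCancellation — and that "any witness must look like an S³-bundle
over S¹ at unit scale" (HHWZ, route apex item `CircleFibration`: a pinched metric on a homotopy `S¹×S³` FIBRES it
over the circle). So the whole open content of X is differential-TOPOLOGICAL, and the skeleton isolates it in one
named stub and makes the two Riemannian/recognition steps separate, individually closable obligations:

* `stub_fibres_over_circle` (T — THE LOAD-BEARING, OPEN stub; "X_Σ fibres over the circle"): for every closed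
  smooth `M ≃ₕ S⁴` some connected sum `P = M # (S¹×S³)` admits a `C^∞` submersion `f : P → S¹` with connected
  fibres (verbatim the conclusion shape of the route's apex item `CircleFibration`). Necessary for X given HHWZ
  (`CircleFibration` + `StabilisationHomotopyType`); sufficient by the three stubs below. Equivalent to SPC4 only
  through Perelman + Cerf + Budney–Gabai (no cheap implication either way: BC3 probes fail). It is the statement of
  the sibling card `s1s3-remembers-fibering-perelman`, here typed and wired to X. Size: open problem.
* `stub_stabilisation_homotopy_type` (B — bridge, folklore, size M): every relational connected sum of a closed
  smooth `M ≃ₕ S⁴` with `S¹×S³` is homotopy equivalent to `S¹×S³`. BY DESIGN the signature of the route's support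
  item `StabilisationHomotopyType` (stmt-SmoothPoincare4-8122): it closes by one line the day that item lands (or a
  prover proves it here with `--supports stmt-SmoothPoincare4-8118`). [KervaireMilnorAnnals1963] [HatcherAT2002]
* `stub_fibred_standard` (R — recognition of FIBRED homotopy `S¹×S³`'s; KNOWN modulo the route's apex inputs,
  size XL): a closed smooth `P ≃ₕ S¹×S³` with a `C^∞` submersion onto `S¹` with connected fibres is diffeomorphic to
  `S¹×S³`. Proof in print: Ehresmann (proper submersion ⇒ fibre bundle, fibre a closed connected 3-manifold `F`);
  homotopy sequence (`π₂(S¹) = 0`, `π₁(P) = ℤ ↠ π₁(S¹)` iso) ⇒ `π₁(F) = 1`; `F ≅ S³` (Perelman = route apex item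
  `PoincareThreeSphere`); `P` = mapping torus of an orientation-preserving `φ ∈ Diff(S³)` (`P` orientable, `w₁`
  homotopy invariant), `φ` isotopic to `id` (Cerf `Γ₄ = 0` / Hatcher = route apex item `CerfTwoComponents`, tree
  named fact `Literature.Topology.FourManifolds.cerf_pi0Diff_sphere_three`) ⇒ `P ≅ S¹×S³`. This is exactly the
  non-HHWZ half of crux #2 `FibrationRecognition` (its foreseen children FibreIsThreeSphere +
  MappingTorusOfSphereStandard, route TWO-LAYER PLAN (a)): `CircleFibration → stub_fibred_standard-sig →`
  (conclusion of FibrationRecognition), so proving it serves both cruxes. A prover lands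
  `PoincareThreeSphere → CerfTwoComponents → (this signature)` with `--supports`; the stub is then open only on the
  two apex facts. [Perelman2002] [Perelman2003a] [CerfDiffeoSphere1968] [Hatcher1983] [Ehresmann1951]
* `stub_pinched_metrics_of_standard` (G — remetrisation, KNOWN, size XL formally): every smooth 4-manifold `P`
  (modelled on `𝓡 4`) diffeomorphic to `S¹×S³` carries, for every `κ > 0` and every `δ > 0`, a `C^∞` metric with
  Levi-Civita connection, `diam ≤ 1`, `Rm(X,Y,Y,X) ≥ −κ·Gram(X,Y)` and `Ric ≥ −δ·g`: pull back the product metric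
  of `S¹(a) × S³(b)` with `π²(a² + b²) ≤ 1` along the diffeomorphism — it has `sec ≥ 0` (mixed planes flat, fibre
  planes `1/b²`), hence `Rm(X,Y,Y,X) ≥ 0 ≥ −κ·Gram` (Cauchy–Schwarz) and `Ric ≥ 0 ≥ −δ·g`, and
  `diam = π·√(a²+b²) ≤ 1`. Every `C^∞` metric of the tree's stack has a Levi-Civita connection
  (`LeviCivitaProofs.hasLeviCivita`, proved; refuter audit on stmt-8117/8118). [Petersen2016, §4.2.3] [ONeill1983]
* `pinchedStabilisation_of_pieces : T-sig → B-sig → R-sig → G-sig → (X unfolded)` — THE REAL COMPOSITION,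
  sorry-free: fix `M ≃ₕ S⁴`; T gives `P = M # (S¹×S³)` fibring over `S¹`; B gives `P ≃ₕ S¹×S³`; R gives
  `P ≅ S¹×S³`; take `κ := 1`; for `δ > 0`, G gives the metric on the SAME `P`.
* `PinchedStabilisation_of : PinchedStabilisation` — THE SKELETON THEOREM: the crux BY NAME from the four declared
  stubs through the composition (the file's only theorem whose head is the crux name; `ledger skeleton check` shape).

`sorry` occurs ONLY in the four `stub_*` theorems.

## Disproof used

None exists: `ledger crux ls stmt-SmoothPoincare4-8118` shows no `Disproof.lean`, no `Lines/*`, no crux ideas, no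
landed `Negative/` lemma (2026-08-17); `ledger negatives --problem SmoothPoincare4` lists no statement about
`S¹×S³`-stabilisations, fibrations over `S¹` or almost-nonnegatively curved metrics. The refuter evidence on the item
(refuters g42-5, g42-25, g42-32, g42-34; 2026-08-15; rc0) certifies the typing this skeleton inherits verbatim: `IsConnectedSum` is the
genuine Kervaire–Milnor pushout (no junk `P`), `∃ _ : HasLeviCivita` is dischargeable, the Gram-form `sec ≥ −κ` and
`Ric ≥ −δ·g` clauses have the right signs, `diam` via `riemannianEDist ≤ 1`; non-vacuity at `M = S⁴` by the
re-modelled product `S¹(a)×S³(b)` — which is precisely stub G.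

## BC3 probes

For each stub `S`: `S → PinchedStabilisation` and `S → SmoothPoincare4` by `first | exact? | simpa | aesop`
(+ `simpa [PinchedStabilisation]`, `unfold; simpa`, `intro h; …` variants), files `bc/probe_*.lean` in the
registrar's folder — all FAIL; raw results in the registrar's NOTES.md and in `Lines/birth.md`.

## References

* H. Huang, X. Huang, B. Wang, X. Zhu, arXiv:2605.24380 (2026), Main Thm 1 (fibration over `T^{b₁}`). [HHWZ2026]
* G. Perelman, arXiv:math/0211159, arXiv:math/0303109; J. Morgan, G. Tian, *Ricci flow and the Poincaré
  conjecture* (2007), Cor. 0.2. [Perelman2002] [Perelman2003a] [MorganTian2007]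
* J. Cerf, *Sur les difféomorphismes de la sphère de dimension trois (Γ₄ = 0)*, LNM 53 (1968); A. Hatcher, Ann.
  Math. 117 (1983). [CerfDiffeoSphere1968] [Hatcher1983]
* C. Ehresmann, Colloque de Topologie, Bruxelles (1950), 29–55 (proper submersions are fibrations). [Ehresmann1951]
* R. Budney, D. Gabai, arXiv:1912.09029, Thm 3.13. [BudneyGabai2019]
* P. Petersen, *Riemannian Geometry*, 3rd ed. (2016), §4.2.3 (product metrics); B. O'Neill, *Semi-Riemannian
  geometry* (1983), Ch. 7. [Petersen2016] [ONeill1983]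
* M. Kervaire, J. Milnor, Ann. Math. 77 (1963), §2; A. Hatcher, *Algebraic Topology* (2002), 4.5.
  [KervaireMilnorAnnals1963] [HatcherAT2002]
-/

-- `Summit.<Summit>.<Problem>`: single-conjunct summit, the duplicate component is mandated (CONVENTIONS §2).
set_option linter.dupNamespace false
set_option linter.unusedVariables false

noncomputable section

namespace Summit.SmoothPoincare4.SmoothPoincare4.Cruxes.PinchedStabilisation.Birth

open scoped Manifold ContDiff Topology ContinuousMap
open Summit.SmoothPoincare4.SmoothPoincare4.Theses.OneHandleSplitting

/-! ## The four registered stubs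

Vocabulary (all inline, Mathlib + the route's Literature imports only; the stubs are spelled out, no notation):
`S¹ := Metric.sphere (0 : EuclideanSpace ℝ (Fin 2)) 1` (model `𝓡 1`), `S³ := Metric.sphere (0 : EuclideanSpace ℝ (Fin 4)) 1`
(model `𝓡 3`), `S⁴ := Metric.sphere (0 : EuclideanSpace ℝ (Fin 5)) 1`, `S¹×S³` with the product model `(𝓡 1).prod (𝓡 3)`;
"`P = M # (S¹×S³)`" is `Literature.Topology.FourManifolds.IsConnectedSum (𝓡 4) (𝓡 4) ((𝓡 1).prod (𝓡 3)) M (S¹×S³) P`;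
"`P` fibres over the circle" is `∃ f : P → S¹, ContMDiff (𝓡 4) (𝓡 1) ∞ f ∧ (∀ x, Surjective (mfderiv (𝓡 4) (𝓡 1) f x)) ∧ ∀ θ, IsConnected (f ⁻¹' {θ})`
(a `C^∞` submersion of the closed `P` onto `S¹` with connected fibres — verbatim the conclusion of the route item
`CircleFibration`); the metric clauses are verbatim those of the crux. -/

/-- **Stub T `stub_fibres_over_circle` — X_Σ FIBRES OVER THE CIRCLE (the load-bearing, open stub).**
For every closed smooth 4-manifold `M ≃ₕ S⁴` some connected sum `P = M # (S¹×S³)` admits a `C^∞` submersion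
`f : P → S¹` with connected fibres. Why plausibly true: it holds for `M = S⁴` (the projection `S¹×S³ → S¹`
transported to a re-modelled copy), and for every `M` it is NECESSARY for the crux (HHWZ Main Thm 1 = route apex
item `CircleFibration`, with `StabilisationHomotopyType`); it is the typed form of "X_Σ remembers a fibering".
Why it might fail: an exotic `Σ` exists — then `Σ # (S¹×S³)` is a homotopy `S¹×S³` that does not fibre (a fibre
would be a homotopy 3-sphere, so `Σ # (S¹×S³) ≅ S¹×S³` by Perelman + Cerf, so `Σ ≅ S⁴` by Budney–Gabai Thm 3.13).
Open (SPC4-hard); no cheap implication to or from the crux / the summit. [arXiv:2605.24380, Main Thm 1]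
[BudneyGabai2019, Thm 3.13] [Kirby1997, Problem 4.89] -/
theorem stub_fibres_over_circle :
    ∀ (M : Type) [TopologicalSpace M] [T2Space M] [SecondCountableTopology M]
      [ChartedSpace (EuclideanSpace ℝ (Fin 4)) M] [IsManifold (𝓡 4) ∞ M] [CompactSpace M],
      M ≃ₕ Metric.sphere (0 : EuclideanSpace ℝ (Fin 5)) 1 →
      ∃ (P : Type) (_ : TopologicalSpace P) (_ : T2Space P) (_ : SecondCountableTopology P)
        (_ : ChartedSpace (EuclideanSpace ℝ (Fin 4)) P) (_ : IsManifold (𝓡 4) ∞ P) (_ : CompactSpace P),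
        Literature.Topology.FourManifolds.IsConnectedSum (𝓡 4) (𝓡 4) ((𝓡 1).prod (𝓡 3)) M
          ((Metric.sphere (0 : EuclideanSpace ℝ (Fin 2)) 1) × (Metric.sphere (0 : EuclideanSpace ℝ (Fin 4)) 1)) P ∧
        ∃ f : P → (Metric.sphere (0 : EuclideanSpace ℝ (Fin 2)) 1),
          ContMDiff (𝓡 4) (𝓡 1) ∞ f ∧ (∀ x : P, Function.Surjective (mfderiv (𝓡 4) (𝓡 1) f x)) ∧
          ∀ θ : (Metric.sphere (0 : EuclideanSpace ℝ (Fin 2)) 1), IsConnected (f ⁻¹' {θ}) := by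
  sorry

/-- **Stub B `stub_stabilisation_homotopy_type` — the bridge to the recognisers' class (folklore, size M).**
Every relational connected sum `P` of a closed smooth `M ≃ₕ S⁴` with `S¹×S³` is homotopy equivalent to `S¹×S³`
(`M` minus a disc is contractible with boundary `S³`, hence `≃ B⁴ rel ∂` by Whitehead; glue). By design the
signature of the route's support item `StabilisationHomotopyType` (stmt-SmoothPoincare4-8122): this obligation
closes by one line when that item lands. [KervaireMilnorAnnals1963, §2] [HatcherAT2002, 4.5] -/
theorem stub_stabilisation_homotopy_type :
    ∀ (M : Type) [TopologicalSpace M] [T2Space M] [SecondCountableTopology M]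
      [ChartedSpace (EuclideanSpace ℝ (Fin 4)) M] [IsManifold (𝓡 4) ∞ M] [CompactSpace M],
      M ≃ₕ Metric.sphere (0 : EuclideanSpace ℝ (Fin 5)) 1 →
      ∀ (P : Type) [TopologicalSpace P] [T2Space P] [SecondCountableTopology P]
        [ChartedSpace (EuclideanSpace ℝ (Fin 4)) P] [IsManifold (𝓡 4) ∞ P] [CompactSpace P],
        Literature.Topology.FourManifolds.IsConnectedSum (𝓡 4) (𝓡 4) ((𝓡 1).prod (𝓡 3)) M
          ((Metric.sphere (0 : EuclideanSpace ℝ (Fin 2)) 1) × (Metric.sphere (0 : EuclideanSpace ℝ (Fin 4)) 1)) P →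
        Nonempty (P ≃ₕ ((Metric.sphere (0 : EuclideanSpace ℝ (Fin 2)) 1) ×
          (Metric.sphere (0 : EuclideanSpace ℝ (Fin 4)) 1))) := by
  sorry

/-- **Stub R `stub_fibred_standard` — FIBRED homotopy `S¹×S³`'s are standard (known modulo the route's apex
inputs Perelman + Cerf; size XL).** A closed smooth 4-manifold `P ≃ₕ S¹×S³` admitting a `C^∞` submersion onto
`S¹` with connected fibres is diffeomorphic to `S¹×S³`. Proof in print: Ehresmann ⇒ `C^∞` fibre bundle with
closed connected fibre `F`; `π₂(S¹) = 0` and `π₁(P) = ℤ ↠ π₁(S¹)` an isomorphism ⇒ `π₁(F) = 1`; `F ≅ S³`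
(Perelman; route apex item `PoincareThreeSphere`); `P` is the mapping torus of an orientation-preserving
self-diffeomorphism of `S³`, isotopic to the identity (Cerf / Hatcher; route apex item `CerfTwoComponents`, tree
fact `cerf_pi0Diff_sphere_three`) ⇒ `P ≅ S¹×S³`. The non-HHWZ half of crux #2 `FibrationRecognition`
(`CircleFibration →` this `→` its conclusion). [Ehresmann1951] [Perelman2003a] [CerfDiffeoSphere1968] [Hatcher1983] -/
theorem stub_fibred_standard :
    ∀ (P : Type) [TopologicalSpace P] [T2Space P] [SecondCountableTopology P]
      [ChartedSpace (EuclideanSpace ℝ (Fin 4)) P] [IsManifold (𝓡 4) ∞ P] [CompactSpace P],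
      P ≃ₕ ((Metric.sphere (0 : EuclideanSpace ℝ (Fin 2)) 1) × (Metric.sphere (0 : EuclideanSpace ℝ (Fin 4)) 1)) →
      (∃ f : P → (Metric.sphere (0 : EuclideanSpace ℝ (Fin 2)) 1),
        ContMDiff (𝓡 4) (𝓡 1) ∞ f ∧ (∀ x : P, Function.Surjective (mfderiv (𝓡 4) (𝓡 1) f x)) ∧
        ∀ θ : (Metric.sphere (0 : EuclideanSpace ℝ (Fin 2)) 1), IsConnected (f ⁻¹' {θ})) →
      Nonempty (P ≃ₘ⟮𝓡 4, (𝓡 1).prod (𝓡 3)⟯ ((Metric.sphere (0 : EuclideanSpace ℝ (Fin 2)) 1) ×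
        (Metric.sphere (0 : EuclideanSpace ℝ (Fin 4)) 1))) := by
  sorry

/-- **Stub G `stub_pinched_metrics_of_standard` — a standard `S¹×S³` carries unit-diameter metrics with
`sec ≥ 0`, in the crux's pinched form (known; size XL formally).** Every smooth 4-manifold `P` (modelled on
`𝓡 4`) diffeomorphic to `S¹×S³` carries, for every `κ > 0` and `δ > 0`, a `C^∞` Riemannian metric `g` with
Levi-Civita connection, `diam(P, g) ≤ 1`, `Rm(X,Y,Y,X) ≥ −κ (g(X,X) g(Y,Y) − g(X,Y)²)` and `Ric ≥ −δ·g`: the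
pull-back of the product metric of `S¹(a) × S³(b)`, `π²(a² + b²) ≤ 1`, has `sec ≥ 0` (mixed planes flat, fibre
planes `1/b²`), so `Rm(X,Y,Y,X) ≥ 0 ≥ −κ·Gram` by Cauchy–Schwarz, `Ric ≥ 0 ≥ −δ·g`, and `diam = π √(a²+b²) ≤ 1`;
Levi-Civita exists for every `C^∞` metric of the tree's stack (`LeviCivitaProofs.hasLeviCivita`). This is the
`SPC4 ⇒ X` sanity computation of the route (CHEAPEST FALSIFIER (v)) as a closed lemma. [Petersen2016, §4.2.3]
[ONeill1983, Ch. 7] -/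
theorem stub_pinched_metrics_of_standard :
    ∀ (P : Type) [TopologicalSpace P] [T2Space P] [SecondCountableTopology P]
      [ChartedSpace (EuclideanSpace ℝ (Fin 4)) P] [IsManifold (𝓡 4) ∞ P] [CompactSpace P],
      Nonempty (P ≃ₘ⟮𝓡 4, (𝓡 1).prod (𝓡 3)⟯ ((Metric.sphere (0 : EuclideanSpace ℝ (Fin 2)) 1) ×
        (Metric.sphere (0 : EuclideanSpace ℝ (Fin 4)) 1))) →
      ∀ κ : ℝ, 0 < κ → ∀ δ : ℝ, 0 < δ →
      ∃ g : Bundle.ContMDiffRiemannianMetric (𝓡 4) ∞ (EuclideanSpace ℝ (Fin 4)) (TangentSpace (𝓡 4) : P → Type _),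
      ∃ _ : (Literature.Geometry.Lorentzian.PseudoRiemannianMetric.ofRiemannian g).HasLeviCivita,
        (open Bundle in letI : Bundle.RiemannianBundle (fun x : P ↦ TangentSpace (𝓡 4) x) :=
          ⟨g.toContinuousRiemannianMetric.toRiemannianMetric⟩; ∀ x y : P, Manifold.riemannianEDist (𝓡 4) x y ≤ 1) ∧
        (∀ (x : P) (X Y : TangentSpace (𝓡 4) x), -κ * (g.inner x X X * g.inner x Y Y - g.inner x X Y ^ 2) ≤
          (Literature.Geometry.Lorentzian.PseudoRiemannianMetric.ofRiemannian g).curvatureForm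
            (Literature.Geometry.Lorentzian.PseudoRiemannianMetric.ofRiemannian g).leviCivita x X Y Y X) ∧
        (∀ (x : P) (w : TangentSpace (𝓡 4) x), -δ * g.inner x w w ≤
          (Literature.Geometry.Lorentzian.PseudoRiemannianMetric.ofRiemannian g).ricci x w w) := by
  sorry

/-! ## The composition: the four stubs prove X -/

/-- **Composition with explicit hypotheses** (`T-sig → B-sig → R-sig → G-sig → X`, the conclusion written as the
crux's one-step unfolding so that `PinchedStabilisation_of` below is the file's only theorem whose head is the
crux name). Proof: fix `M ≃ₕ S⁴`; T yields `P = M # (S¹×S³)` with a submersion onto `S¹` with connected fibres;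
B makes `P` a homotopy `S¹×S³`; R makes it diffeomorphic to `S¹×S³`; `κ := 1`; for `δ > 0`, G yields the metric
on the same `P`. Sorry-free, standard axioms. [folklore] -/
theorem pinchedStabilisation_of_pieces
    (hT : ∀ (M : Type) [TopologicalSpace M] [T2Space M] [SecondCountableTopology M]
      [ChartedSpace (EuclideanSpace ℝ (Fin 4)) M] [IsManifold (𝓡 4) ∞ M] [CompactSpace M],
      M ≃ₕ Metric.sphere (0 : EuclideanSpace ℝ (Fin 5)) 1 →
      ∃ (P : Type) (_ : TopologicalSpace P) (_ : T2Space P) (_ : SecondCountableTopology P)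
        (_ : ChartedSpace (EuclideanSpace ℝ (Fin 4)) P) (_ : IsManifold (𝓡 4) ∞ P) (_ : CompactSpace P),
        Literature.Topology.FourManifolds.IsConnectedSum (𝓡 4) (𝓡 4) ((𝓡 1).prod (𝓡 3)) M
          ((Metric.sphere (0 : EuclideanSpace ℝ (Fin 2)) 1) × (Metric.sphere (0 : EuclideanSpace ℝ (Fin 4)) 1)) P ∧
        ∃ f : P → (Metric.sphere (0 : EuclideanSpace ℝ (Fin 2)) 1),
          ContMDiff (𝓡 4) (𝓡 1) ∞ f ∧ (∀ x : P, Function.Surjective (mfderiv (𝓡 4) (𝓡 1) f x)) ∧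
          ∀ θ : (Metric.sphere (0 : EuclideanSpace ℝ (Fin 2)) 1), IsConnected (f ⁻¹' {θ}))
    (hB : ∀ (M : Type) [TopologicalSpace M] [T2Space M] [SecondCountableTopology M]
      [ChartedSpace (EuclideanSpace ℝ (Fin 4)) M] [IsManifold (𝓡 4) ∞ M] [CompactSpace M],
      M ≃ₕ Metric.sphere (0 : EuclideanSpace ℝ (Fin 5)) 1 →
      ∀ (P : Type) [TopologicalSpace P] [T2Space P] [SecondCountableTopology P]
        [ChartedSpace (EuclideanSpace ℝ (Fin 4)) P] [IsManifold (𝓡 4) ∞ P] [CompactSpace P],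
        Literature.Topology.FourManifolds.IsConnectedSum (𝓡 4) (𝓡 4) ((𝓡 1).prod (𝓡 3)) M
          ((Metric.sphere (0 : EuclideanSpace ℝ (Fin 2)) 1) × (Metric.sphere (0 : EuclideanSpace ℝ (Fin 4)) 1)) P →
        Nonempty (P ≃ₕ ((Metric.sphere (0 : EuclideanSpace ℝ (Fin 2)) 1) ×
          (Metric.sphere (0 : EuclideanSpace ℝ (Fin 4)) 1))))
    (hR : ∀ (P : Type) [TopologicalSpace P] [T2Space P] [SecondCountableTopology P]
      [ChartedSpace (EuclideanSpace ℝ (Fin 4)) P] [IsManifold (𝓡 4) ∞ P] [CompactSpace P],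
      P ≃ₕ ((Metric.sphere (0 : EuclideanSpace ℝ (Fin 2)) 1) × (Metric.sphere (0 : EuclideanSpace ℝ (Fin 4)) 1)) →
      (∃ f : P → (Metric.sphere (0 : EuclideanSpace ℝ (Fin 2)) 1),
        ContMDiff (𝓡 4) (𝓡 1) ∞ f ∧ (∀ x : P, Function.Surjective (mfderiv (𝓡 4) (𝓡 1) f x)) ∧
        ∀ θ : (Metric.sphere (0 : EuclideanSpace ℝ (Fin 2)) 1), IsConnected (f ⁻¹' {θ})) →
      Nonempty (P ≃ₘ⟮𝓡 4, (𝓡 1).prod (𝓡 3)⟯ ((Metric.sphere (0 : EuclideanSpace ℝ (Fin 2)) 1) ×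
        (Metric.sphere (0 : EuclideanSpace ℝ (Fin 4)) 1))))
    (hG : ∀ (P : Type) [TopologicalSpace P] [T2Space P] [SecondCountableTopology P]
      [ChartedSpace (EuclideanSpace ℝ (Fin 4)) P] [IsManifold (𝓡 4) ∞ P] [CompactSpace P],
      Nonempty (P ≃ₘ⟮𝓡 4, (𝓡 1).prod (𝓡 3)⟯ ((Metric.sphere (0 : EuclideanSpace ℝ (Fin 2)) 1) ×
        (Metric.sphere (0 : EuclideanSpace ℝ (Fin 4)) 1))) →
      ∀ κ : ℝ, 0 < κ → ∀ δ : ℝ, 0 < δ →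
      ∃ g : Bundle.ContMDiffRiemannianMetric (𝓡 4) ∞ (EuclideanSpace ℝ (Fin 4)) (TangentSpace (𝓡 4) : P → Type _),
      ∃ _ : (Literature.Geometry.Lorentzian.PseudoRiemannianMetric.ofRiemannian g).HasLeviCivita,
        (open Bundle in letI : Bundle.RiemannianBundle (fun x : P ↦ TangentSpace (𝓡 4) x) :=
          ⟨g.toContinuousRiemannianMetric.toRiemannianMetric⟩; ∀ x y : P, Manifold.riemannianEDist (𝓡 4) x y ≤ 1) ∧
        (∀ (x : P) (X Y : TangentSpace (𝓡 4) x), -κ * (g.inner x X X * g.inner x Y Y - g.inner x X Y ^ 2) ≤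
          (Literature.Geometry.Lorentzian.PseudoRiemannianMetric.ofRiemannian g).curvatureForm
            (Literature.Geometry.Lorentzian.PseudoRiemannianMetric.ofRiemannian g).leviCivita x X Y Y X) ∧
        (∀ (x : P) (w : TangentSpace (𝓡 4) x), -δ * g.inner x w w ≤
          (Literature.Geometry.Lorentzian.PseudoRiemannianMetric.ofRiemannian g).ricci x w w)) :
    ∀ (M : Type) [TopologicalSpace M] [T2Space M] [SecondCountableTopology M]
      [ChartedSpace (EuclideanSpace ℝ (Fin 4)) M] [IsManifold (𝓡 4) ∞ M] [CompactSpace M],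
      M ≃ₕ Metric.sphere (0 : EuclideanSpace ℝ (Fin 5)) 1 →
      ∃ κ : ℝ, 0 < κ ∧ ∀ δ : ℝ, 0 < δ →
      ∃ (P : Type) (_ : TopologicalSpace P) (_ : T2Space P) (_ : SecondCountableTopology P)
        (_ : ChartedSpace (EuclideanSpace ℝ (Fin 4)) P) (_ : IsManifold (𝓡 4) ∞ P) (_ : CompactSpace P),
        Literature.Topology.FourManifolds.IsConnectedSum (𝓡 4) (𝓡 4) ((𝓡 1).prod (𝓡 3)) M
          ((Metric.sphere (0 : EuclideanSpace ℝ (Fin 2)) 1) × (Metric.sphere (0 : EuclideanSpace ℝ (Fin 4)) 1)) P ∧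
        ∃ g : Bundle.ContMDiffRiemannianMetric (𝓡 4) ∞ (EuclideanSpace ℝ (Fin 4)) (TangentSpace (𝓡 4) : P → Type _),
        ∃ _ : (Literature.Geometry.Lorentzian.PseudoRiemannianMetric.ofRiemannian g).HasLeviCivita,
          (open Bundle in letI : Bundle.RiemannianBundle (fun x : P ↦ TangentSpace (𝓡 4) x) :=
            ⟨g.toContinuousRiemannianMetric.toRiemannianMetric⟩; ∀ x y : P, Manifold.riemannianEDist (𝓡 4) x y ≤ 1) ∧
          (∀ (x : P) (X Y : TangentSpace (𝓡 4) x), -κ * (g.inner x X X * g.inner x Y Y - g.inner x X Y ^ 2) ≤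
            (Literature.Geometry.Lorentzian.PseudoRiemannianMetric.ofRiemannian g).curvatureForm
              (Literature.Geometry.Lorentzian.PseudoRiemannianMetric.ofRiemannian g).leviCivita x X Y Y X) ∧
          (∀ (x : P) (w : TangentSpace (𝓡 4) x), -δ * g.inner x w w ≤
            (Literature.Geometry.Lorentzian.PseudoRiemannianMetric.ofRiemannian g).ricci x w w) := by
  intro M _ _ _ _ _ _ e
  -- T: a connected sum P = M # (S¹×S³) fibring smoothly over the circle
  obtain ⟨P, i₁, i₂, i₃, i₄, i₅, i₆, hsum, hfib⟩ := hT M e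
  -- B: P is a homotopy S¹×S³;  R: a fibred homotopy S¹×S³ is diffeomorphic to S¹×S³
  obtain ⟨e'⟩ := hB M e P hsum
  have hstd := hR P e' hfib
  -- κ := 1; for every δ > 0, G: the pulled-back product metric on the same P
  refine ⟨1, one_pos, fun δ hδ => ?_⟩
  obtain ⟨g, hLC, hdiam, hsec, hric⟩ := hG P hstd 1 one_pos δ hδ
  exact ⟨P, i₁, i₂, i₃, i₄, i₅, i₆, hsum, g, hLC, hdiam, hsec, hric⟩

/-- **THE SKELETON THEOREM.** The crux `Summit.SmoothPoincare4.SmoothPoincare4.Theses.OneHandleSplitting.PinchedStabilisation`,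
concluded BY NAME from the four DECLARED stubs `stub_fibres_over_circle`, `stub_stabilisation_homotopy_type`,
`stub_fibred_standard`, `stub_pinched_metrics_of_standard` (the only `sorry`s of the file) through the sorry-free
composition `pinchedStabilisation_of_pieces`. [folklore] -/
theorem PinchedStabilisation_of :
    Summit.SmoothPoincare4.SmoothPoincare4.Theses.OneHandleSplitting.PinchedStabilisation :=
  pinchedStabilisation_of_pieces stub_fibres_over_circle stub_stabilisation_homotopy_type stub_fibred_standard
    stub_pinched_metrics_of_standard

end Summit.SmoothPoincare4.SmoothPoincare4.Cruxes.PinchedStabilisation.Birth
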